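import Literature.NumberTheory.Weil1964.UnitaryArchSingularCentralizerTopFormHaar     -- ★ A-p19: `IsSingularArchFrame`
import Literature.NumberTheory.Automorphic.ArchTorusWeylAction                       -- ★ `archDiagTorus`, `coe_archDiagTorus_eq_diagonal`; ★ `Literature.LinearAlgebra.Matrix.monomial`
import Literature.NumberTheory.NumberFields.CMFieldRealSignApproximation             -- ★ p844136 (b5) FILE 1: `exists_complexConj_eq_re_embedding_mul_pos`
import HarnessLib

/-!
# FRAMES AT EVERY RELABELLED RATIONAL-TYPE WALL TORUS POINT of `U(diag α)(L⁺ ⊗ ℝ)` («(b5)» FILE 2; Rogawski 1990 §3.8 Prop. 3.8.1 (a), §8.2, §14.5)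

Topic `NumberTheory/Weil1964`; namespace `Literature.NumberTheory.Weil1964.UnitaryArchTopForm` (home of ★ `IsSingularArchFrame`).  THEOREMS ONLY (no `def`, no instance, no
notation, no axiom, no named fact, no `sorry`).  Cell `pub/hodgecm-mathlib`, ENGINE T1 (crux H413 = `stmt-HodgeConjecture-24833`); the (ST-∞) witness road, brick (b5) «frames on the
whole archimedean stable class» (F0P3-p03 (g11); F0P3a-p07 (g10) (W7) map §3 (b5) ∕ 11:59:17Z; LEAD F0P3a-plan (g10) WORD T9-22 (3)).  Count-neutral; HONEST LABEL: HC_CM is proved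
only modulo the printed citations until rung 0 closes; pays nothing by itself.

WHAT.  `α : Fin 3 → L` real non-zero (the diagonal frame of an inner form), `zw` a wall datum of RATIONAL TYPE — `zw_w = (σ_w a, σ_w b, σ_w a)` with `a, b ∈ L` — and ANY family of
relabellings `ρ = (ρ_w)`.  Then the torus point `t(zw∘ρ) ∈ U(diag α)(L⁺ ⊗ ℝ)` admits a singular archimedean frame `(a, b, T, H_a, H_b)` (★ `IsSingularArchFrame`): RATIONAL diagonal
blocks `H_a = diag(h₀, h₁)`, `H_b = (h₂)` with `h_j ∈ L⁺` of the SAME SIGN AS `α_{π_w j}` AT EVERY PLACE `w` (`π_w := ρ_w⁻¹ ∘ (1 2)` sorts the eigenvalues `(a, a, b)`; the `h_j` exist by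
weak approximation, ★ (b5) FILE 1), and `T_w = monomial π_w c_w` with the positive real scalings `c_{w,j} = √(σ_w h_j ∕ σ_w α_{π_w j})` (assembled over the places by ★ `GLnMixedPiEquiv`):
`T_wᴴ · σ_w(diag α) · T_w = σ_w(diag h)` and `diag(zw_w ∘ ρ_w) · T_w = T_w · diag(σ_w a, σ_w a, σ_w b)` (★ `monomial` calculus).
* **`exists_isSingularArchFrame_archDiagTorus_wall`** — the frame, with the eigenvalues `a, b` read off the rational type;
* **`exists_isSingularArchFrame_archDiagTorus_wall'`** — the `∃ a b T H_a H_b` form (the «framed» predicate of ★ `centralizerTopFormHaar`, ★ (U) `hframe`, ★ (W4f) (W-a)).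
The stable class of a non-central singular rational `γ₀ ⊗ 1` in `U(H′)(L⁺ ⊗ ℝ)` consists, through the congruence `U(H′) ≃ U(diag α′)`, of the classes of these torus points
(★ (W4c′) `exists_conj_archDiagTorus_eq_archCongr_of_not_central`); the frames there follow by ★ `IsSingularArchFrame.conj` ∕ `.of_formCongr` ((b5) FILE 3).

## References
* [Rogawski1990] J. D. Rogawski, *Automorphic Representations of Unitary Groups in Three Variables*, Ann. of Math. Stud. 123 (1990), §3.8 Prop. 3.8.1 (a) p. 27; §8.2 p. 122;
  §14.5 Lemma 14.5.2 (b) p. 239.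
* [PlatonovRapinchuk1994] V. Platonov, A. Rapinchuk, *Algebraic Groups and Number Theory* (1994), §1.2 (weak approximation), §2.3 (unitary groups of hermitian forms).
* [BrockerTomDieck1985] T. Bröcker, T. tom Dieck, *Representations of Compact Lie Groups* (1985), IV (3.2) (monomial matrices).
-/

set_option autoImplicit false

noncomputable section

open NumberField NumberField.InfinitePlace NumberField.mixedEmbedding Matrix Equiv
open Literature.NumberTheory.Automorphic Literature.NumberTheory.Automorphic.UnitaryGroup Literature.LinearAlgebra.Matrix
open Literature.NumberTheory.NumberFields
open scoped MatrixGroups ComplexConjugate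

/-! ## §1 Monomial calculus over `ℂ` (two identities) -/

namespace Literature.LinearAlgebra.Matrix

/-- `M(π, c)ᴴ · diag(d) · M(π, c) = diag(c̄_j · d_{π j} · c_j)` (★ `conjTranspose_monomial`, ★ `monomial_mul_diagonal`, ★ `monomial_mul_monomial`). [cite: BrockerTomDieck1985, IV (3.2)] -/
theorem conjTranspose_monomial_mul_diagonal_mul_monomial' {N : ℕ} (π : Perm (Fin N)) (c d : Fin N → ℂ) :
    (monomial π c)ᴴ * diagonal d * monomial π c = diagonal (fun j => star (c j) * d (π j) * c j) := by
  rw [conjTranspose_monomial, monomial_mul_diagonal, monomial_mul_monomial, inv_mul_cancel, monomial_one]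
  congr 1
  funext j
  rw [Equiv.Perm.inv_def, Equiv.symm_apply_apply]

/-- `diag(z) · M(π, c) = M(π, c) · diag(e)` when `z_{π j} = e_j` (★ `diagonal_mul_monomial`, ★ `monomial_mul_diagonal`). [cite: BrockerTomDieck1985, IV (3.2)] -/
theorem diagonal_mul_monomial_eq_monomial_mul_diagonal {N : ℕ} {R : Type*} [CommRing R] (π : Perm (Fin N)) (c z e : Fin N → R) (h : ∀ j, z (π j) = e j) :
    diagonal z * monomial π c = monomial π c * diagonal e := by
  rw [diagonal_mul_monomial, monomial_mul_diagonal]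
  congr 1
  funext j
  rw [h j, mul_comm]

end Literature.LinearAlgebra.Matrix

namespace Literature.NumberTheory.Weil1964

namespace UnitaryArchTopForm

variable (L : Type) [Field L] [NumberField L] [IsCMField L]

/-! ## §2 Matrix bookkeeping over `L⁺ ⊗ ℝ`: equalities are checked at the complex places -/

/-- Two matrices over `L ⊗ ℝ` (CM field `L`: no real place) are equal iff their images under every complex coordinate `evalC w` are (★ `mixedSpace_ext`). [folklore] -/
private theorem matrix_eq_of_forall_map_evalC {m n : ℕ} {M₁ M₂ : Matrix (Fin m) (Fin n) (mixedSpace L)}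
    (h : ∀ w : {w : InfinitePlace L // IsComplex w}, M₁.map (evalC L w) = M₂.map (evalC L w)) : M₁ = M₂ :=
  Matrix.ext fun i j => mixedSpace_ext (↥(maximalRealSubfield L)) L (IsCMField.complexConj L) (IsCMField.complexConj_ne_one L) (complexConj_smul_infinitePlace L)
    fun w => congrFun (congrFun (h w) i) j

/-- `(a·1₂ ⊕ᶠ b·1₁) = diag(a, a, b)` (★ `finSum`). [folklore] -/
private theorem finSum_smul_one_smul_one_eq_diagonal {K : Type*} [CommRing K] (a b : K) :
    finSum 2 1 (a • (1 : Matrix (Fin 2) (Fin 2) K)) (b • (1 : Matrix (Fin 1) (Fin 1) K)) = Matrix.diagonal ![a, a, b] := by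
  rw [finSum, Matrix.smul_one_eq_diagonal, Matrix.smul_one_eq_diagonal, Matrix.fromBlocks_diagonal, Matrix.reindex_apply,
    Matrix.submatrix_diagonal_equiv]
  congr 1
  funext i
  fin_cases i <;> rfl

/-- `diag(h₀, h₁) ⊕ᶠ diag(h₂) = diag(h₀, h₁, h₂)` (★ `finSum`). [folklore] -/
private theorem finSum_diagonal_two_one_eq_diagonal {K : Type*} [CommRing K] (h : Fin 3 → K) :
    finSum 2 1 (Matrix.diagonal ![h 0, h 1]) (Matrix.diagonal ![h 2]) = Matrix.diagonal h := by
  rw [finSum, Matrix.fromBlocks_diagonal, Matrix.reindex_apply, Matrix.submatrix_diagonal_equiv]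
  congr 1
  funext i
  fin_cases i <;> rfl

/-! ## §3 The frame at a relabelled rational-type wall torus point -/

/-- **FRAMES AT EVERY RELABELLED RATIONAL-TYPE WALL TORUS POINT.**  `α` real non-zero, `zw_w = (σ_w a, σ_w b, σ_w a)` a wall datum of rational type, `ρ` any relabelling family:
`(a, b, T, diag(h₀, h₁), (h₂))` is a singular archimedean frame of `t(zw∘ρ) ∈ U(diag α)(L⁺ ⊗ ℝ)` for suitable `h_j ∈ L⁺` (signs of `α_{π_w j}` at every place, ★ weak approximation)
and `T = (monomial π_w c_w)_w`, `π_w = ρ_w⁻¹ ∘ (1 2)`, `c_{w,j} = √(σ_w h_j ∕ σ_w α_{π_w j})`. [cite: Rogawski1990, §3.8 Prop. 3.8.1 (a) p. 27; §8.2 p. 122] [cite: PlatonovRapinchuk1994, §1.2, §2.3] -/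
theorem exists_isSingularArchFrame_archDiagTorus_wall (α : Fin 3 → L) (hα : ∀ i, α i ≠ 0) (hhermα : ∀ i, (IsCMField.complexConj L (α i) : L) = α i)
    (zw : {w : InfinitePlace L // IsComplex w} → Fin 3 → Circle) (hw : ∀ w, zw w 0 = zw w 2 ∧ zw w 0 ≠ zw w 1)
    {a b : L} (hrat : ∀ w : {w : InfinitePlace L // IsComplex w}, ((zw w 0 : ℂ) = w.1.embedding a) ∧ ((zw w 1 : ℂ) = w.1.embedding b))
    (ρ : {w : InfinitePlace L // IsComplex w} → Perm (Fin 3)) :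
    ∃ (T : GL (Fin 3) (mixedSpace L)) (H_a : Matrix (Fin 2) (Fin 2) L) (H_b : Matrix (Fin 1) (Fin 1) L),
      IsSingularArchFrame L (Matrix.diagonal α) (archDiagTorus L 3 α fun w => zw w ∘ ⇑(ρ w)) a b T H_a H_b := by
  classical
  have hc := IsCMField.complexConj_ne_one L
  have hfix := complexConj_smul_infinitePlace L
  -- `a ≠ b` (read at any place)
  obtain ⟨w₀⟩ : Nonempty {w : InfinitePlace L // IsComplex w} := ⟨⟨Classical.arbitrary (InfinitePlace L), IsTotallyComplex.isComplex _⟩⟩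
  have hab : a ≠ b := by
    intro h
    apply (hw w₀).2
    apply Circle.ext
    rw [(hrat w₀).1, (hrat w₀).2, h]
  -- the sorting permutation at every place: `ρ_w (π_w j) = (1 2) j`
  let π : {w : InfinitePlace L // IsComplex w} → Perm (Fin 3) := fun w => (ρ w)⁻¹ * Equiv.swap (1 : Fin 3) 2
  have hπ : ∀ w j, ρ w (π w j) = Equiv.swap (1 : Fin 3) 2 j := fun w j => by
    show ρ w (((ρ w)⁻¹ * Equiv.swap (1 : Fin 3) 2) j) = _
    rw [Perm.mul_apply, Equiv.Perm.inv_def, Equiv.apply_symm_apply]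
  -- the eigenvalue pattern after sorting: `zw_w (ρ_w (π_w j)) = (σ a, σ a, σ b)_j`
  have hz : ∀ w (j : Fin 3), ((zw w (ρ w (π w j)) : Circle) : ℂ) = ![w.1.embedding a, w.1.embedding a, w.1.embedding b] j := by
    intro w j
    rw [hπ]
    match j with
    | 0 => rw [Equiv.swap_apply_of_ne_of_ne (by decide) (by decide)]; exact (hrat w).1
    | 1 => rw [Equiv.swap_apply_left, ← (hw w).1]; exact (hrat w).1
    | 2 => rw [Equiv.swap_apply_right]; exact (hrat w).2
  -- `σ`-fixed elements are real at every complex embedding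
  have him : ∀ {x : L}, IsCMField.complexConj L x = x → ∀ w : {w : InfinitePlace L // IsComplex w}, (w.1.embedding x).im = 0 := fun hx w => by
    rw [← Complex.conj_eq_iff_im, ← IsCMField.complexEmbedding_complexConj, hx]
  -- real parts of the frame entries are non-zero; signs `h_j ∈ L⁺` by weak approximation
  have hαre : ∀ (w : {w : InfinitePlace L // IsComplex w}) (i : Fin 3), (w.1.embedding (α i)).re ≠ 0 := by
    intro w i hre
    apply hα i
    have h0 : w.1.embedding (α i) = 0 := Complex.ext hre (him (hhermα i) w)
    exact (map_eq_zero _).1 h0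
  have hsig : ∀ j : Fin 3, ∃ hj : L, IsCMField.complexConj L hj = hj ∧ ∀ w : {w : InfinitePlace L // IsComplex w}, 0 < (w.1.embedding hj).re * (w.1.embedding (α (π w j))).re :=
    fun j => exists_complexConj_eq_re_embedding_mul_pos L (fun w : {w : InfinitePlace L // IsComplex w} => (w.1.embedding (α (π w j))).re) (fun w => hαre w _)
  choose h hh hpos using hsig
  have hhre : ∀ (w : {w : InfinitePlace L // IsComplex w}) (j : Fin 3), (w.1.embedding (h j)).re ≠ 0 := fun w j hz0 => by
    have := hpos j w; rw [hz0, zero_mul] at this; exact lt_irrefl _ this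
  have hh0 : ∀ j, h j ≠ 0 := fun j hz0 => hhre w₀ j (by rw [hz0, map_zero, Complex.zero_re])
  -- the positive real scalings
  let r : {w : InfinitePlace L // IsComplex w} → Fin 3 → ℝ := fun w j => Real.sqrt ((w.1.embedding (h j)).re / (w.1.embedding (α (π w j))).re)
  have hratio : ∀ (w : {w : InfinitePlace L // IsComplex w}) (j : Fin 3), 0 < (w.1.embedding (h j)).re / (w.1.embedding (α (π w j))).re := fun w j => by
    have hq : 0 < (w.1.embedding (α (π w j))).re * (w.1.embedding (α (π w j))).re := mul_self_pos.2 (hαre w _)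
    have : (w.1.embedding (h j)).re / (w.1.embedding (α (π w j))).re =
        ((w.1.embedding (h j)).re * (w.1.embedding (α (π w j))).re) / ((w.1.embedding (α (π w j))).re * (w.1.embedding (α (π w j))).re) := by
      field_simp
    rw [this]
    exact div_pos (hpos j w) hq
  have hr : ∀ w j, 0 < r w j := fun w j => Real.sqrt_pos.2 (hratio w j)
  have hrsq : ∀ (w : {w : InfinitePlace L // IsComplex w}) (j : Fin 3), r w j * r w j * (w.1.embedding (α (π w j))).re = (w.1.embedding (h j)).re := fun w j => by
    show Real.sqrt _ * Real.sqrt _ * _ = _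
    rw [Real.mul_self_sqrt (hratio w j).le, div_mul_cancel₀ _ (hαre w _)]
  -- the per-place frame matrices and the global `T`
  let cw : {w : InfinitePlace L // IsComplex w} → Fin 3 → ℂ := fun w j => (r w j : ℂ)
  have hdet : ∀ w, (monomial (π w) (cw w)).det ≠ 0 := fun w => by
    rw [det_monomial]
    refine mul_ne_zero ?_ (Finset.prod_ne_zero_iff.2 fun j _ => ?_)
    · exact_mod_cast Units.ne_zero (Perm.sign (π w))
    · show ((r w j : ℝ) : ℂ) ≠ 0
      exact Complex.ofReal_ne_zero.2 (hr w j).ne'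
  let T : GL (Fin 3) (mixedSpace L) :=
    (GLnMixedPiEquiv (↥(maximalRealSubfield L)) L (IsCMField.complexConj L) 3 hc hfix).symm fun w => Matrix.GeneralLinearGroup.mkOfDetNeZero _ (hdet w)
  have hTw : ∀ w, (T : Matrix (Fin 3) (Fin 3) (mixedSpace L)).map (evalC L w) = monomial (π w) (cw w) := fun w => by
    have e := congrArg (fun g : GL (Fin 3) ℂ => (g : Matrix (Fin 3) (Fin 3) ℂ))
      (map_evalC_GLnMixedPiEquiv_symm (↥(maximalRealSubfield L)) L (IsCMField.complexConj L) 3 hc hfix (fun w => Matrix.GeneralLinearGroup.mkOfDetNeZero _ (hdet w)) w)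
    rw [Matrix.GeneralLinearGroup.val_mkOfDetNeZero] at e
    exact e
  -- real numbers as complex numbers: `σ_w (α i) = Re σ_w (α i)`, `σ_w (h j) = Re σ_w (h j)`
  have hαC : ∀ (w : {w : InfinitePlace L // IsComplex w}) (i : Fin 3), w.1.embedding (α i) = ((w.1.embedding (α i)).re : ℂ) := fun w i =>
    Complex.ext (by simp) (by simpa using him (hhermα i) w)
  have hhC : ∀ (w : {w : InfinitePlace L // IsComplex w}) (j : Fin 3), w.1.embedding (h j) = ((w.1.embedding (h j)).re : ℂ) := fun w j =>
    Complex.ext (by simp) (by simpa using him (hh j) w)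
  refine ⟨T, Matrix.diagonal ![h 0, h 1], Matrix.diagonal ![h 2], hab, ?_, ?_, ?_, ?_, ?_, ?_⟩
  · -- `H_a` hermitian (real diagonal)
    rw [Matrix.diagonal_map (map_zero _), Matrix.diagonal_transpose]
    congr 1; funext i; fin_cases i
    · exact hh 0
    · exact hh 1
  · rw [Matrix.diagonal_map (map_zero _), Matrix.diagonal_transpose]
    congr 1; funext i; fin_cases i
    exact hh 2
  · rw [Matrix.det_diagonal, isUnit_iff_ne_zero, Finset.prod_ne_zero_iff]
    intro i _; fin_cases i
    · exact hh0 0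
    · exact hh0 1
  · rw [Matrix.det_diagonal, isUnit_iff_ne_zero, Finset.prod_ne_zero_iff]
    intro i _; fin_cases i
    exact hh0 2
  · -- the form: `σ(T)ᵀ (diag α)′ T = (diag h)′`, checked at every place
    rw [finSum_diagonal_two_one_eq_diagonal]
    refine matrix_eq_of_forall_map_evalC L fun w => ?_
    have hconjT : (((T : Matrix (Fin 3) (Fin 3) (mixedSpace L)).map (conjMixed (↥(maximalRealSubfield L)) L (IsCMField.complexConj L)))ᵀ).map (evalC L w) =
        (monomial (π w) (cw w))ᴴ := by
      rw [Matrix.transpose_map, Matrix.map_map, ← hTw]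
      show _ = (((T : Matrix (Fin 3) (Fin 3) (mixedSpace L)).map (evalC L w))ᵀ).map star
      rw [Matrix.transpose_map, Matrix.map_map]
      congr 2
      funext x
      exact evalC_conjMixed (↥(maximalRealSubfield L)) L (IsCMField.complexConj L) (hfix w.1) hc x
    rw [formCongr, Matrix.map_mul, Matrix.map_mul, hconjT, hTw, archFormOf_map_evalC, archFormOf_map_evalC,
      Matrix.diagonal_map (map_zero _), Matrix.diagonal_map (map_zero _), conjTranspose_monomial_mul_diagonal_mul_monomial']
    congr 1
    funext j
    show star ((r w j : ℂ)) * w.1.embedding (α (π w j)) * (r w j : ℂ) = w.1.embedding (h j)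
    rw [Complex.star_def, Complex.conj_ofReal, hαC, hhC, ← hrsq w j]
    push_cast
    ring
  · -- the eigen-equation: `diag(zw_w∘ρ_w) · T_w = T_w · diag(σ a, σ a, σ b)` at every place
    refine matrix_eq_of_forall_map_evalC L fun w => ?_
    rw [Matrix.map_mul, Matrix.map_mul, hTw, coe_archDiagTorus_eq_diagonal, finSum_smul_one_smul_one_eq_diagonal,
      Matrix.diagonal_map (map_zero _), Matrix.diagonal_map (map_zero _)]
    refine diagonal_mul_monomial_eq_monomial_mul_diagonal (π w) (cw w) _ _ fun j => ?_
    simp only [evalC_apply, Function.comp_apply]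
    rw [hz]
    match j with
    | 0 => simp [mixedEmbedding_apply_isComplex]
    | 1 => simp [mixedEmbedding_apply_isComplex]
    | 2 => simp [mixedEmbedding_apply_isComplex]

/-- **The «framed» predicate at every relabelled rational-type wall torus point** (∃-form of the previous theorem): the `hframe` binder of ★ (U)
`smul_centralizerTopFormHaar_of_universal_pinRatio` and the frame guard of ★ (W4f) discharged on the wall classes. [cite: Rogawski1990, §3.8 Prop. 3.8.1 (a) p. 27; §8.2 p. 122] -/
theorem exists_isSingularArchFrame_archDiagTorus_wall' (α : Fin 3 → L) (hα : ∀ i, α i ≠ 0) (hhermα : ∀ i, (IsCMField.complexConj L (α i) : L) = α i)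
    (zw : {w : InfinitePlace L // IsComplex w} → Fin 3 → Circle) (hw : ∀ w, zw w 0 = zw w 2 ∧ zw w 0 ≠ zw w 1)
    (hrat : ∃ a b : L, ∀ w : {w : InfinitePlace L // IsComplex w}, ((zw w 0 : ℂ) = w.1.embedding a) ∧ ((zw w 1 : ℂ) = w.1.embedding b))
    (ρ : {w : InfinitePlace L // IsComplex w} → Perm (Fin 3)) :
    ∃ (a b : L) (T : GL (Fin 3) (mixedSpace L)) (H_a : Matrix (Fin 2) (Fin 2) L) (H_b : Matrix (Fin 1) (Fin 1) L),
      IsSingularArchFrame L (Matrix.diagonal α) (archDiagTorus L 3 α fun w => zw w ∘ ⇑(ρ w)) a b T H_a H_b := by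
  obtain ⟨a, b, hab⟩ := hrat
  obtain ⟨T, H_a, H_b, hf⟩ := exists_isSingularArchFrame_archDiagTorus_wall L α hα hhermα zw hw hab ρ
  exact ⟨a, b, T, H_a, H_b, hf⟩

/-- **FRAMES AT EVERY RELABELLED RATIONAL-TYPE WALL TORUS POINT — THE DATA EXPOSED** (EDITION 2; the (U) road's BRIDGE, owner A-p19 (g24) ruling R-U1 13:13:09Z): the frame of
★ `exists_isSingularArchFrame_archDiagTorus_wall` WITH its data: a real non-zero diagonal carrier `h`, positive real scalings `c w j` with `c_{w,j}² · re σ_w(α_{π_w j}) = re σ_w(h_j)`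
for the sorting permutation `π_w = ρ_w⁻¹ ∘ (1 2)`, the sign law `0 < re σ_w(h_j) · re σ_w(α_{π_w j})`, the per-place frame matrix `evalC_w T = monomial π_w c_w`, and the blocks
`H_a = diag(h₀, h₁)`, `H_b = (h₂)` — so that the local frame map of this frame FACTORS as relabelling ∘ torus-fixing diagonal congruence ∘ block embedding (U3a).
[cite: Rogawski1990, §3.8 Prop. 3.8.1 (a) p. 27; §8.2 p. 122] [cite: PlatonovRapinchuk1994, §1.2, §2.3] -/
theorem exists_isSingularArchFrame_archDiagTorus_wall_exposed (α : Fin 3 → L) (hα : ∀ i, α i ≠ 0) (hhermα : ∀ i, (IsCMField.complexConj L (α i) : L) = α i)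
    (zw : {w : InfinitePlace L // IsComplex w} → Fin 3 → Circle) (hw : ∀ w, zw w 0 = zw w 2 ∧ zw w 0 ≠ zw w 1)
    {a b : L} (hrat : ∀ w : {w : InfinitePlace L // IsComplex w}, ((zw w 0 : ℂ) = w.1.embedding a) ∧ ((zw w 1 : ℂ) = w.1.embedding b))
    (ρ : {w : InfinitePlace L // IsComplex w} → Perm (Fin 3)) :
    ∃ (h : Fin 3 → L) (c : {w : InfinitePlace L // IsComplex w} → Fin 3 → ℝ) (T : GL (Fin 3) (mixedSpace L)),
      (∀ j, h j ≠ 0) ∧ (∀ j, IsCMField.complexConj L (h j) = h j) ∧ (∀ w j, 0 < c w j) ∧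
      (∀ (w : {w : InfinitePlace L // IsComplex w}) (j : Fin 3), 0 < (w.1.embedding (h j)).re * (w.1.embedding (α (((ρ w)⁻¹ * Equiv.swap (1 : Fin 3) 2) j))).re) ∧
      (∀ (w : {w : InfinitePlace L // IsComplex w}) (j : Fin 3), c w j * c w j * (w.1.embedding (α (((ρ w)⁻¹ * Equiv.swap (1 : Fin 3) 2) j))).re = (w.1.embedding (h j)).re) ∧
      (∀ w : {w : InfinitePlace L // IsComplex w}, (T : Matrix (Fin 3) (Fin 3) (mixedSpace L)).map (evalC L w) = monomial ((ρ w)⁻¹ * Equiv.swap (1 : Fin 3) 2) (fun j => (c w j : ℂ))) ∧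
      IsSingularArchFrame L (Matrix.diagonal α) (archDiagTorus L 3 α fun w => zw w ∘ ⇑(ρ w)) a b T (Matrix.diagonal ![h 0, h 1]) (Matrix.diagonal ![h 2]) := by
  classical
  have hc := IsCMField.complexConj_ne_one L
  have hfix := complexConj_smul_infinitePlace L
  -- `a ≠ b` (read at any place)
  obtain ⟨w₀⟩ : Nonempty {w : InfinitePlace L // IsComplex w} := ⟨⟨Classical.arbitrary (InfinitePlace L), IsTotallyComplex.isComplex _⟩⟩
  have hab : a ≠ b := by
    intro h
    apply (hw w₀).2
    apply Circle.ext
    rw [(hrat w₀).1, (hrat w₀).2, h]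
  -- the sorting permutation at every place: `ρ_w (π_w j) = (1 2) j`
  let π : {w : InfinitePlace L // IsComplex w} → Perm (Fin 3) := fun w => (ρ w)⁻¹ * Equiv.swap (1 : Fin 3) 2
  have hπ : ∀ w j, ρ w (π w j) = Equiv.swap (1 : Fin 3) 2 j := fun w j => by
    show ρ w (((ρ w)⁻¹ * Equiv.swap (1 : Fin 3) 2) j) = _
    rw [Perm.mul_apply, Equiv.Perm.inv_def, Equiv.apply_symm_apply]
  -- the eigenvalue pattern after sorting: `zw_w (ρ_w (π_w j)) = (σ a, σ a, σ b)_j`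
  have hz : ∀ w (j : Fin 3), ((zw w (ρ w (π w j)) : Circle) : ℂ) = ![w.1.embedding a, w.1.embedding a, w.1.embedding b] j := by
    intro w j
    rw [hπ]
    match j with
    | 0 => rw [Equiv.swap_apply_of_ne_of_ne (by decide) (by decide)]; exact (hrat w).1
    | 1 => rw [Equiv.swap_apply_left, ← (hw w).1]; exact (hrat w).1
    | 2 => rw [Equiv.swap_apply_right]; exact (hrat w).2
  -- `σ`-fixed elements are real at every complex embedding
  have him : ∀ {x : L}, IsCMField.complexConj L x = x → ∀ w : {w : InfinitePlace L // IsComplex w}, (w.1.embedding x).im = 0 := fun hx w => by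
    rw [← Complex.conj_eq_iff_im, ← IsCMField.complexEmbedding_complexConj, hx]
  -- real parts of the frame entries are non-zero; signs `h_j ∈ L⁺` by weak approximation
  have hαre : ∀ (w : {w : InfinitePlace L // IsComplex w}) (i : Fin 3), (w.1.embedding (α i)).re ≠ 0 := by
    intro w i hre
    apply hα i
    have h0 : w.1.embedding (α i) = 0 := Complex.ext hre (him (hhermα i) w)
    exact (map_eq_zero _).1 h0
  have hsig : ∀ j : Fin 3, ∃ hj : L, IsCMField.complexConj L hj = hj ∧ ∀ w : {w : InfinitePlace L // IsComplex w}, 0 < (w.1.embedding hj).re * (w.1.embedding (α (π w j))).re :=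
    fun j => exists_complexConj_eq_re_embedding_mul_pos L (fun w : {w : InfinitePlace L // IsComplex w} => (w.1.embedding (α (π w j))).re) (fun w => hαre w _)
  choose h hh hpos using hsig
  have hhre : ∀ (w : {w : InfinitePlace L // IsComplex w}) (j : Fin 3), (w.1.embedding (h j)).re ≠ 0 := fun w j hz0 => by
    have := hpos j w; rw [hz0, zero_mul] at this; exact lt_irrefl _ this
  have hh0 : ∀ j, h j ≠ 0 := fun j hz0 => hhre w₀ j (by rw [hz0, map_zero, Complex.zero_re])
  -- the positive real scalings
  let r : {w : InfinitePlace L // IsComplex w} → Fin 3 → ℝ := fun w j => Real.sqrt ((w.1.embedding (h j)).re / (w.1.embedding (α (π w j))).re)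
  have hratio : ∀ (w : {w : InfinitePlace L // IsComplex w}) (j : Fin 3), 0 < (w.1.embedding (h j)).re / (w.1.embedding (α (π w j))).re := fun w j => by
    have hq : 0 < (w.1.embedding (α (π w j))).re * (w.1.embedding (α (π w j))).re := mul_self_pos.2 (hαre w _)
    have : (w.1.embedding (h j)).re / (w.1.embedding (α (π w j))).re =
        ((w.1.embedding (h j)).re * (w.1.embedding (α (π w j))).re) / ((w.1.embedding (α (π w j))).re * (w.1.embedding (α (π w j))).re) := by
      field_simp
    rw [this]
    exact div_pos (hpos j w) hq
  have hr : ∀ w j, 0 < r w j := fun w j => Real.sqrt_pos.2 (hratio w j)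
  have hrsq : ∀ (w : {w : InfinitePlace L // IsComplex w}) (j : Fin 3), r w j * r w j * (w.1.embedding (α (π w j))).re = (w.1.embedding (h j)).re := fun w j => by
    show Real.sqrt _ * Real.sqrt _ * _ = _
    rw [Real.mul_self_sqrt (hratio w j).le, div_mul_cancel₀ _ (hαre w _)]
  -- the per-place frame matrices and the global `T`
  let cw : {w : InfinitePlace L // IsComplex w} → Fin 3 → ℂ := fun w j => (r w j : ℂ)
  have hdet : ∀ w, (monomial (π w) (cw w)).det ≠ 0 := fun w => by
    rw [det_monomial]
    refine mul_ne_zero ?_ (Finset.prod_ne_zero_iff.2 fun j _ => ?_)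
    · exact_mod_cast Units.ne_zero (Perm.sign (π w))
    · show ((r w j : ℝ) : ℂ) ≠ 0
      exact Complex.ofReal_ne_zero.2 (hr w j).ne'
  let T : GL (Fin 3) (mixedSpace L) :=
    (GLnMixedPiEquiv (↥(maximalRealSubfield L)) L (IsCMField.complexConj L) 3 hc hfix).symm fun w => Matrix.GeneralLinearGroup.mkOfDetNeZero _ (hdet w)
  have hTw : ∀ w, (T : Matrix (Fin 3) (Fin 3) (mixedSpace L)).map (evalC L w) = monomial (π w) (cw w) := fun w => by
    have e := congrArg (fun g : GL (Fin 3) ℂ => (g : Matrix (Fin 3) (Fin 3) ℂ))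
      (map_evalC_GLnMixedPiEquiv_symm (↥(maximalRealSubfield L)) L (IsCMField.complexConj L) 3 hc hfix (fun w => Matrix.GeneralLinearGroup.mkOfDetNeZero _ (hdet w)) w)
    rw [Matrix.GeneralLinearGroup.val_mkOfDetNeZero] at e
    exact e
  -- real numbers as complex numbers: `σ_w (α i) = Re σ_w (α i)`, `σ_w (h j) = Re σ_w (h j)`
  have hαC : ∀ (w : {w : InfinitePlace L // IsComplex w}) (i : Fin 3), w.1.embedding (α i) = ((w.1.embedding (α i)).re : ℂ) := fun w i =>
    Complex.ext (by simp) (by simpa using him (hhermα i) w)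
  have hhC : ∀ (w : {w : InfinitePlace L // IsComplex w}) (j : Fin 3), w.1.embedding (h j) = ((w.1.embedding (h j)).re : ℂ) := fun w j =>
    Complex.ext (by simp) (by simpa using him (hh j) w)
  refine ⟨h, r, T, hh0, hh, hr, fun w j => hpos j w, hrsq, fun w => hTw w, hab, ?_, ?_, ?_, ?_, ?_, ?_⟩
  · -- `H_a` hermitian (real diagonal)
    rw [Matrix.diagonal_map (map_zero _), Matrix.diagonal_transpose]
    congr 1; funext i; fin_cases i
    · exact hh 0
    · exact hh 1
  · rw [Matrix.diagonal_map (map_zero _), Matrix.diagonal_transpose]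
    congr 1; funext i; fin_cases i
    exact hh 2
  · rw [Matrix.det_diagonal, isUnit_iff_ne_zero, Finset.prod_ne_zero_iff]
    intro i _; fin_cases i
    · exact hh0 0
    · exact hh0 1
  · rw [Matrix.det_diagonal, isUnit_iff_ne_zero, Finset.prod_ne_zero_iff]
    intro i _; fin_cases i
    exact hh0 2
  · -- the form: `σ(T)ᵀ (diag α)′ T = (diag h)′`, checked at every place
    rw [finSum_diagonal_two_one_eq_diagonal]
    refine matrix_eq_of_forall_map_evalC L fun w => ?_
    have hconjT : (((T : Matrix (Fin 3) (Fin 3) (mixedSpace L)).map (conjMixed (↥(maximalRealSubfield L)) L (IsCMField.complexConj L)))ᵀ).map (evalC L w) =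
        (monomial (π w) (cw w))ᴴ := by
      rw [Matrix.transpose_map, Matrix.map_map, ← hTw]
      show _ = (((T : Matrix (Fin 3) (Fin 3) (mixedSpace L)).map (evalC L w))ᵀ).map star
      rw [Matrix.transpose_map, Matrix.map_map]
      congr 2
      funext x
      exact evalC_conjMixed (↥(maximalRealSubfield L)) L (IsCMField.complexConj L) (hfix w.1) hc x
    rw [formCongr, Matrix.map_mul, Matrix.map_mul, hconjT, hTw, archFormOf_map_evalC, archFormOf_map_evalC,
      Matrix.diagonal_map (map_zero _), Matrix.diagonal_map (map_zero _), conjTranspose_monomial_mul_diagonal_mul_monomial']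
    congr 1
    funext j
    show star ((r w j : ℂ)) * w.1.embedding (α (π w j)) * (r w j : ℂ) = w.1.embedding (h j)
    rw [Complex.star_def, Complex.conj_ofReal, hαC, hhC, ← hrsq w j]
    push_cast
    ring
  · -- the eigen-equation: `diag(zw_w∘ρ_w) · T_w = T_w · diag(σ a, σ a, σ b)` at every place
    refine matrix_eq_of_forall_map_evalC L fun w => ?_
    rw [Matrix.map_mul, Matrix.map_mul, hTw, coe_archDiagTorus_eq_diagonal, finSum_smul_one_smul_one_eq_diagonal,
      Matrix.diagonal_map (map_zero _), Matrix.diagonal_map (map_zero _)]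
    refine diagonal_mul_monomial_eq_monomial_mul_diagonal (π w) (cw w) _ _ fun j => ?_
    simp only [evalC_apply, Function.comp_apply]
    rw [hz]
    match j with
    | 0 => simp [mixedEmbedding_apply_isComplex]
    | 1 => simp [mixedEmbedding_apply_isComplex]
    | 2 => simp [mixedEmbedding_apply_isComplex]

/-- `evalC_w T` as an element of `GL₃(ℂ)`: the matrix of `GL.map (evalC L w) T` is `(T : Matrix).map (evalC L w)` (definitional), so the exposed frame reads
`↑(GL.map (evalC L w) T) = monomial π_w c_w`. [cite: Rogawski1990, §3.8 Prop. 3.8.1 (a) p. 27] -/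
theorem exists_isSingularArchFrame_archDiagTorus_wall_exposed' (α : Fin 3 → L) (hα : ∀ i, α i ≠ 0) (hhermα : ∀ i, (IsCMField.complexConj L (α i) : L) = α i)
    (zw : {w : InfinitePlace L // IsComplex w} → Fin 3 → Circle) (hw : ∀ w, zw w 0 = zw w 2 ∧ zw w 0 ≠ zw w 1)
    {a b : L} (hrat : ∀ w : {w : InfinitePlace L // IsComplex w}, ((zw w 0 : ℂ) = w.1.embedding a) ∧ ((zw w 1 : ℂ) = w.1.embedding b))
    (ρ : {w : InfinitePlace L // IsComplex w} → Perm (Fin 3)) :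
    ∃ (h : Fin 3 → L) (c : {w : InfinitePlace L // IsComplex w} → Fin 3 → ℝ) (T : GL (Fin 3) (mixedSpace L)),
      (∀ j, h j ≠ 0) ∧ (∀ j, IsCMField.complexConj L (h j) = h j) ∧ (∀ w j, 0 < c w j) ∧
      (∀ (w : {w : InfinitePlace L // IsComplex w}) (j : Fin 3), 0 < (w.1.embedding (h j)).re * (w.1.embedding (α (((ρ w)⁻¹ * Equiv.swap (1 : Fin 3) 2) j))).re) ∧
      (∀ (w : {w : InfinitePlace L // IsComplex w}) (j : Fin 3), c w j * c w j * (w.1.embedding (α (((ρ w)⁻¹ * Equiv.swap (1 : Fin 3) 2) j))).re = (w.1.embedding (h j)).re) ∧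
      (∀ w : {w : InfinitePlace L // IsComplex w}, ((Matrix.GeneralLinearGroup.map (evalC L w) T : GL (Fin 3) ℂ) : Matrix (Fin 3) (Fin 3) ℂ) =
        monomial ((ρ w)⁻¹ * Equiv.swap (1 : Fin 3) 2) (fun j => (c w j : ℂ))) ∧
      IsSingularArchFrame L (Matrix.diagonal α) (archDiagTorus L 3 α fun w => zw w ∘ ⇑(ρ w)) a b T (Matrix.diagonal ![h 0, h 1]) (Matrix.diagonal ![h 2]) := by
  obtain ⟨h, c, T, h1, h2, h3, h4, h5, h6, h7⟩ := exists_isSingularArchFrame_archDiagTorus_wall_exposed L α hα hhermα zw hw hrat ρ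
  exact ⟨h, c, T, h1, h2, h3, h4, h5, fun w => h6 w, h7⟩

end UnitaryArchTopForm

end Literature.NumberTheory.Weil1964

end
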